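import Summits.FinalStateConjecture.FinalStateConjecture.Statement
import Literature.Geometry.Lorentzian.TrivialDataAdmissible
import Literature.Geometry.Lorentzian.LeafAdaptedModelChartsMinkowski
import Literature.Geometry.Lorentzian.MGHDUniqueness
import Summits.FinalStateConjecture.FinalStateConjecture.Theorems.WeakCosmicCensorshipMGHD.Negative.LoadBearing
import Summits.FinalStateConjecture.FinalStateConjecture.Theorems.SeamedChartsExhaust.Negative.ReversedFlatChart

/-!
# `UniversalWitnessFamily` (crux stmt-FinalStateConjecture-10051, route SwallowTheDatum) — negative-side
# lemmas II: the model point is settled (the Minkowski development of the trivial datum satisfies the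
# summit's full typed post-maximality conclusion)

Refuter seat `refuter-cdisprove-stmt-FinalStateConjecture-10051-0`, 2026-08-16, cycle 1; workfile
`Cruxes/UniversalWitnessFamily/Disproof.lean` (§6). BOUNDARY LEMMA of the disproof attempt: the only road to
`¬UniversalWitnessFamily` that needs no maximal development in hand is a TYPED DEFECT of the summit's
post-maximality conclusion `Q(𝒟)` (complete `𝓘⁺` in the sojourn form ∧ an exhaustive sub-extremal Kerr
decomposition of the self-determined exterior) biting every vacuum Cauchy development of an open set of
admissible data (companion file `Readback.lean`, `not_uwf_of_universal_defect`). This file closes that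
road at the model point: `Q` HOLDS in the vacuum Cauchy development `Minkowski.vacuumCauchyDevelopment` of
the admissible datum `(ℝ³, δ, 0)` (`settledIn_minkowski`), by

* complete future null infinity — the sibling lane's `minkowski_hasCompleteNullInfinity`
  (`WeakCosmicCensorshipMGHD/Negative/LoadBearing.lean`);
* the HONEST `N = 0` decomposition `minkowskiDecomp`: identity flat chart on `U₀ = E4` after `τ₀ = 0`, zero `C²`
  deviation (tree: `Minkowski.deviationExtend_vacuumCauchyDevelopment_subtypeVal`), region
  `O = {x⁰ ≥ 0}` which IS the self-determined exterior `J⁺(ι ℝ³) ∩ I⁻(charted)`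
  (`causalFuture_range_sliceEmbed`: `J⁺({x⁰ = 0}) = {x⁰ ≥ 0}`; `chronologicalPast_late`:
  `I⁻({x⁰ > τ}) = ℝ⁴`; `minkowskiExterior_eq_exteriorOf`), and `HasExhaustiveCharts` by vertical timelike segments
  (`hasExhaustiveCharts_minkowskiDecomp`) — the pattern of the sibling lane
  `SeamedChartsExhaust/Negative/ReversedFlatChart.lean` with the honest time direction.

Consequences: `exists_settledIn_admissible` (the typed `Q` is satisfiable by a development of an
admissible datum: no clause of it is a defect at the dispersal end) and `settles_trivialData_of` — the
summit's `P(trivialData)` owes EXACTLY maximality of the Minkowski development (Choquet-Bruhat–Geroch in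
its simplest case, not in the tree) and transport of `Q` along isometries of developments; MGHD
uniqueness is the tree theorem `VacuumCauchyDevelopment.isIsometricTo_of_isMaximal'`. Nothing here closes
the item; `sorry`-free, standard axioms, no named fact introduced.

## References

* D. Christodoulou, S. Klainerman, *The global nonlinear stability of the Minkowski space* (1993),
  Thm. 1.0.2 (Minkowski space as the trivial final state).
* B. O'Neill, *Semi-Riemannian geometry* (1983), Ch. 14, p. 402 (causality of `ℝ⁴₁`).
* M. Dafermos, G. Holzegel, I. Rodnianski, M. Taylor, arXiv:2104.08222, §1 (late-time charts).
* M. Dafermos, J. Luk, arXiv:1710.01722, Conjecture 1 (the conclusion).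
* Y. Choquet-Bruhat, R. Geroch, Comm. Math. Phys. 14 (1969), Thm. 3.
-/

noncomputable section

open Bundle TopologicalSpace Manifold Set Function Filter
open scoped ContDiff Topology

namespace Summit.FinalStateConjecture.FinalStateConjecture.Theorems.UniversalWitnessFamily.Negative

open Literature.Geometry.Lorentzian
open Summit.FinalStateConjecture.FinalStateConjecture.Theorems.WeakCosmicCensorshipMGHD.Negative
  (minkowski_hasCompleteNullInfinity)

/-! ## §6 The model point: the Minkowski development of the trivial datum IS settled

The boundary lemma closing the universal-defect road of §2 at `d = trivialData`: every clause of the typed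
post-maximality conclusion `Q` holds in the vacuum Cauchy development `Minkowski.vacuumCauchyDevelopment`
of the admissible datum `(ℝ³, δ, 0)` — complete `𝓘⁺` (sibling lane `minkowski_hasCompleteNullInfinity`)
and the honest `N = 0` decomposition: identity flat chart on `U₀ = E4` after `τ₀ = 0`, region
`O = {x⁰ ≥ 0}`, which IS the self-determined exterior `J⁺({x⁰ = 0}) ∩ I⁻({x⁰ > 0})`, zero deviation,
and exhaustion by vertical timelike segments. (Pattern of the sibling lane
`SeamedChartsExhaust/Negative/ReversedFlatChart.lean`, with the HONEST time direction.) -/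

section MinkowskiModel

open Summit.FinalStateConjecture.FinalStateConjecture.Theorems.SeamedChartsExhaust.Negative.ReversedModel
  (mem_chronologicalFuture_add_smul time_le_of_mem_causalPast_singleton
    exists_mem_causalPast_singleton_of_mem_causalPast)

/-- The region `O = {x⁰ ≥ 0}` of Minkowski spacetime (the causal future of the data slice). -/
def minkowskiExterior : Set E4 := {x | 0 ≤ x 0}

/-- The identity flat chart on all of `E4`. -/
def idFlatChart : (⊤ : Opens E4) → E4 := fun y ↦ y.1

/-- The late flat region `{x⁰ > τ}` in the identity chart. [folklore] -/
theorem image_idFlatChart_lateRegion (τ : ℝ) :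
    idFlatChart '' (Minkowski.backgroundOn ⊤).lateRegion τ = {x : E4 | τ < x 0} := by
  ext x
  constructor
  · rintro ⟨y, hy, rfl⟩
    exact hy
  · intro hx
    exact ⟨⟨x, trivial⟩, hx, rfl⟩

/-- The flat slab `{x⁰ = τ}` in the identity chart. [folklore] -/
theorem image_idFlatChart_timeSlab (τ : ℝ) :
    idFlatChart '' (Minkowski.backgroundOn ⊤).timeSlab τ = {x : E4 | x 0 = τ} := by
  ext x
  constructor
  · rintro ⟨y, hy, rfl⟩
    exact hy
  · intro hx
    exact ⟨⟨x, trivial⟩, hx, rfl⟩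

/-- The identity chart is an exact isometry of `η`: its extended deviation vanishes identically (tree:
`Minkowski.deviationExtend_vacuumCauchyDevelopment_subtypeVal`). [cite: ChristodoulouKlainerman1993, Thm. 1.0.2] -/
theorem deviationExtend_idFlatChart :
    Minkowski.spacetime.deviationExtend (Minkowski.backgroundOn ⊤) idFlatChart = 0 :=
  Minkowski.deviationExtend_vacuumCauchyDevelopment_subtypeVal

/-- The identity flat chart is a late-time chart into `O = {x⁰ ≥ 0}` after `τ₀ = 0` (smoothness and
open-embedding as in the tree's `isLateChart_vacuumCauchyDevelopment_subtypeVal`; the late image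
`{x⁰ > 0}` lies in `O`). [cite: arXiv210408222, §1] -/
theorem isLateChart_idFlatChart : Minkowski.spacetime.IsLateChart (Minkowski.backgroundOn ⊤) minkowskiExterior 0 idFlatChart := by
  refine ⟨?_, ?_, ?_⟩
  · exact contMDiff_subtype_val
  · have hlate : IsOpen ((Minkowski.backgroundOn ⊤).lateRegion 0) :=
      isOpen_lt continuous_const ((PiLp.continuous_apply 2 _ 0).comp continuous_subtype_val)
    exact (IsOpen.isOpenEmbedding_subtypeVal (⊤ : Opens E4).isOpen).comp
      (IsOpen.isOpenEmbedding_subtypeVal hlate)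
  · intro (x : E4) hx
    have hx' : x ∈ (idFlatChart '' (Minkowski.backgroundOn ⊤).lateRegion 0 : Set E4) := hx
    rw [image_idFlatChart_lateRegion] at hx'
    have : (0 : ℝ) < x 0 := hx'
    show (0 : ℝ) ≤ x 0
    exact this.le

/-- **The honest `N = 0` final-state decomposition of `O = {x⁰ ≥ 0} ⊆ ℝ⁴`** by the identity flat
chart of Minkowski spacetime: no hole, flat domain all of `E4`, `τ₀ = 0`, zero `C²` deviation, and the
covering clause holds because a point of `O` not later than `0` lies ON the initial flat slab.
Christodoulou–Klainerman 1993, Thm. 1.0.2 (Minkowski space is its own final state).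
[cite: ChristodoulouKlainerman1993, Thm. 1.0.2] -/
def minkowskiDecomp : FinalStateDecomposition Minkowski.spacetime minkowskiExterior 2 where
  N := 0
  mass := Fin.elim0
  spin := Fin.elim0
  mass_pos i := i.elim0
  abs_spin_le_mass i := i.elim0
  motion := Fin.elim0
  τ₀ := 0
  chart i := i.elim0
  isLateChart i := i.elim0
  tendsto_truncDeviationCk i := i.elim0
  exists_pairwise_disjoint _ := ⟨0, fun i ↦ i.elim0⟩
  excision := Fin.elim0
  tendsto_excision_div i := i.elim0
  flatDomain := ⊤
  setOf_lt_excision_subset_flatDomain _ _ := trivial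
  flatChart := idFlatChart
  isLateChart_flat := isLateChart_idFlatChart
  tendsto_deviationCk_flat := by
    have h : ∀ τ, Minkowski.spacetime.deviationCk (Minkowski.backgroundOn ⊤) idFlatChart 2 τ = 0 := fun τ ↦ by
      rw [Spacetime.deviationCk, deviationExtend_idFlatChart, supCkENorm_zero]
    simp_rw [h]
    exact tendsto_const_nhds
  diff_subset_causalPast := by
    intro (x : E4) hx
    have hx0 : (0 : ℝ) ≤ x 0 := hx.1
    have hxle : x 0 ≤ 0 := by
      refine not_lt.mp fun hlt ↦ hx.2 (Or.inr ?_)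
      have : x ∈ (idFlatChart '' (Minkowski.backgroundOn ⊤).lateRegion 0 : Set E4) := by
        rw [image_idFlatChart_lateRegion]; exact hlt
      exact this
    refine LorentzianMetric.subset_causalPast _ _ _ (Or.inr ?_)
    have : x ∈ (idFlatChart '' (Minkowski.backgroundOn ⊤).timeSlab 0 : Set E4) := by
      rw [image_idFlatChart_timeSlab]; exact le_antisymm hxle hx0
    exact this

/-- `minkowskiDecomp` starts at `τ₀ = 0` (by `rfl`). [folklore] -/
theorem minkowskiDecomp_τ₀ : minkowskiDecomp.τ₀ = 0 := rfl

/-- The flat chart of `minkowskiDecomp` is the identity chart (by `rfl`). [folklore] -/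
theorem minkowskiDecomp_flatChart : minkowskiDecomp.flatChart = idFlatChart := rfl

/-- `minkowskiDecomp` has no hole. [folklore] -/
instance : IsEmpty (Fin minkowskiDecomp.N) := Fin.isEmpty'

/-- The charted late region of `minkowskiDecomp` is the open half-space `{x⁰ > 0}`. [folklore] -/
theorem charted_minkowskiDecomp : minkowskiDecomp.charted = {x : E4 | 0 < x 0} := by
  rw [FinalStateDecomposition.charted, iUnion_of_empty, union_empty,
    FinalStateDecomposition.radiationZone, minkowskiDecomp_flatChart, minkowskiDecomp_τ₀]
  exact image_idFlatChart_lateRegion 0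

/-- **`J⁺({x⁰ = 0}) = {x⁰ ≥ 0}`** in Minkowski spacetime (solid cones, `Minkowski.causalFuture_singleton`).
[cite: ONeill1983, Ch. 14 p. 402] -/
theorem causalFuture_range_sliceEmbed :
    Minkowski.spacetime.metric.causalFuture Minkowski.spacetime.timeOrientation
      (range Minkowski.sliceEmbed) = minkowskiExterior := by
  refine Set.ext fun (x : E4) ↦ ⟨fun hx ↦ ?_, fun hx ↦ ?_⟩
  · rw [LorentzianMetric.causalFuture_eq_biUnion] at hx
    obtain ⟨p, hp, hxp⟩ := mem_iUnion₂.1 hx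
    obtain ⟨y, rfl⟩ := hp
    have h' : x ∈ {q : E4 | ‖E4.spatial q - E4.spatial (Minkowski.sliceEmbed y)‖ ≤
        q 0 - (Minkowski.sliceEmbed y : E4) 0} := by
      rw [← Minkowski.causalFuture_singleton]; exact hxp
    have h'' : ‖E4.spatial x - E4.spatial (Minkowski.sliceEmbed y)‖ ≤
        x 0 - (Minkowski.sliceEmbed y : E4) 0 := h'
    rw [Minkowski.sliceEmbed_apply, E4.ofTimeSpace_apply_zero, sub_zero] at h''
    show (0 : ℝ) ≤ x 0
    exact (norm_nonneg _).trans h''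
  · have hx' : (0 : ℝ) ≤ x 0 := hx
    have hJ : x ∈ Minkowski.spacetime.metric.causalFuture Minkowski.spacetime.timeOrientation
        ({E4.ofTimeSpace 0 (E4.spatial x)} : Set E4) := by
      refine Minkowski.mem_causalFuture_vacuumCauchyDevelopment ?_
      simp only [E4.spatial_ofTimeSpace, sub_self, norm_zero, E4.ofTimeSpace_apply_zero, sub_zero]
      exact hx'
    refine LorentzianMetric.causalFuture_mono (M := Minkowski.spacetime.carrier) ?_ hJ
    exact singleton_subset_iff.mpr ⟨⟨E4.spatial x, trivial⟩, rfl⟩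

/-- **`I⁻({x⁰ > τ}) = ℝ⁴`**: every event is in the chronological past of the late half-space (vertical
timelike segment `x ≪ x + s e₀`). [cite: ONeill1983, Ch. 14 p. 402] -/
theorem chronologicalPast_late (τ : ℝ) :
    Minkowski.spacetime.metric.chronologicalPast Minkowski.spacetime.timeOrientation
      {x : E4 | τ < x 0} = univ := by
  refine eq_univ_of_forall fun (x : E4) ↦ ?_
  set s : ℝ := |x 0| + |τ| + 1 with hs_def
  have hs : 0 < s := by positivity
  have hmem : x + s • E4.basisVector 0 ∈ {x : E4 | τ < x 0} := by
    show τ < (x + s • E4.basisVector 0) 0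
    have h1 : (x + s • E4.basisVector 0) 0 = x 0 + s := by simp
    rw [h1, hs_def]
    linarith [le_abs_self τ, neg_abs_le (x 0)]
  have h1 : x ∈ Minkowski.spacetime.metric.chronologicalPast Minkowski.spacetime.timeOrientation
      {x + s • E4.basisVector 0} :=
    LorentzianMetric.mem_chronologicalPast_of_mem_chronologicalFuture (M := Minkowski.spacetime.carrier)
      (mem_chronologicalFuture_add_smul hs)
  exact LorentzianMetric.chronologicalFuture_mono (M := Minkowski.spacetime.carrier)
    (singleton_subset_iff.mpr hmem) h1

/-- **`O = {x⁰ ≥ 0}` is the self-determined exterior of the decomposition**, in the Minkowski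
development of the trivial datum: `O = J⁺(ι ℝ³) ∩ I⁻(charted)`. [cite: DafermosLuk2017, Conjecture 1] -/
theorem minkowskiExterior_eq_exteriorOf :
    minkowskiExterior = Summit.FinalStateConjecture.exteriorOf Minkowski.vacuumCauchyDevelopment.toCauchyDevelopment
      minkowskiDecomp.charted := by
  change minkowskiExterior = Minkowski.spacetime.metric.causalFuture Minkowski.spacetime.timeOrientation
      (range Minkowski.sliceEmbed) ∩
    Minkowski.spacetime.metric.chronologicalPast Minkowski.spacetime.timeOrientation minkowskiDecomp.charted
  rw [charted_minkowskiDecomp]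
  refine Set.ext fun (x : E4) ↦ ⟨fun hx ↦ ⟨?_, ?_⟩, fun hx ↦ ?_⟩
  · exact (Set.ext_iff.mp causalFuture_range_sliceEmbed x).mpr hx
  · exact (Set.ext_iff.mp (chronologicalPast_late 0) x).mpr (mem_univ x)
  · exact (Set.ext_iff.mp causalFuture_range_sliceEmbed x).mp hx.1

/-- **The identity chart exhausts `O`**: for every `τ₁ > 0`, a point of `O` not flat-late after `τ₁` has
`0 ≤ x⁰ ≤ τ₁` and lies in the causal past of `(τ₁, x̲)` on the certified slab `{x⁰ = τ₁}` (vertical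
segment, `Minkowski.causalPast_singleton`); the near-zone clause is vacuous (`N = 0`).
[cite: DafermosLuk2017, Conjecture 1 (b)–(c)] -/
theorem hasExhaustiveCharts_minkowskiDecomp : Summit.FinalStateConjecture.HasExhaustiveCharts minkowskiDecomp := by
  refine ⟨Fin.elim0, fun i ↦ i.elim0, fun i ↦ i.elim0, ?_⟩
  rintro τ₁ - (x : E4) hx
  have hxle : x 0 ≤ τ₁ := by
    refine not_lt.mp fun hlt ↦ hx.2 (Or.inl ?_)
    have : x ∈ (idFlatChart '' (Minkowski.backgroundOn ⊤).lateRegion τ₁ : Set E4) := by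
      rw [image_idFlatChart_lateRegion]; exact hlt
    exact this
  have hJ : x ∈ Minkowski.spacetime.metric.causalPast Minkowski.spacetime.timeOrientation
      ({E4.ofTimeSpace τ₁ (E4.spatial x)} : Set E4) := by
    refine Minkowski.mem_causalPast_vacuumCauchyDevelopment ?_
    simp only [E4.spatial_ofTimeSpace, sub_self, norm_zero, E4.ofTimeSpace_apply_zero, sub_nonneg]
    exact hxle
  refine LorentzianMetric.causalFuture_mono (M := Minkowski.spacetime.carrier) ?_ hJ
  refine singleton_subset_iff.mpr (Or.inl ?_)
  have : E4.ofTimeSpace τ₁ (E4.spatial x) ∈ (idFlatChart '' (Minkowski.backgroundOn ⊤).timeSlab τ₁ : Set E4) := by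
    rw [image_idFlatChart_timeSlab]; exact E4.ofTimeSpace_apply_zero τ₁ _
  exact this

/-- **THE MODEL POINT IS SETTLED.** The Minkowski development of the trivial datum `(ℝ³, δ, 0)` satisfies
the full typed post-maximality conclusion `Q` of the summit: complete future null infinity in the
sojourn form (`minkowski_hasCompleteNullInfinity`) and the honest, exhaustive, (vacuously) sub-extremal
`N = 0` decomposition `minkowskiDecomp` of its self-determined exterior `{x⁰ ≥ 0}`. Hence NO clause of `Q` is a
typed defect at the dispersal end: the universal-defect road of §2 is closed at `d = trivialData`.
Christodoulou–Klainerman 1993, Thm. 1.0.2. [cite: ChristodoulouKlainerman1993, Thm. 1.0.2] -/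
theorem settledIn_minkowski :
    letI 𝒟 := Minkowski.vacuumCauchyDevelopment
    (Summit.FinalStateConjecture.HasCompleteNullInfinity 𝒟.toCauchyDevelopment ∧
      ∃ (O : Set 𝒟.carrier) (dec : FinalStateDecomposition 𝒟.toSpacetime O 2),
        (∀ i, Kerr.IsSubextremal (dec.mass i) (dec.spin i)) ∧
          O = Summit.FinalStateConjecture.exteriorOf 𝒟.toCauchyDevelopment dec.charted ∧
            Summit.FinalStateConjecture.HasExhaustiveCharts dec) :=
  ⟨minkowski_hasCompleteNullInfinity, minkowskiExterior, minkowskiDecomp, fun i ↦ i.elim0, minkowskiExterior_eq_exteriorOf,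
    hasExhaustiveCharts_minkowskiDecomp⟩

/-- So some vacuum Cauchy development of an ADMISSIBLE datum is settled (anti-vacuity of `Q` over `𝓓`). -/
theorem exists_settledIn_admissible :
    ∃ e ∈ admissibleVacuumData Minkowski.slice, ∃ 𝒟 : VacuumCauchyDevelopment e,
      (Summit.FinalStateConjecture.HasCompleteNullInfinity 𝒟.toCauchyDevelopment ∧
      ∃ (O : Set 𝒟.carrier) (dec : FinalStateDecomposition 𝒟.toSpacetime O 2),
        (∀ i, Kerr.IsSubextremal (dec.mass i) (dec.spin i)) ∧
          O = Summit.FinalStateConjecture.exteriorOf 𝒟.toCauchyDevelopment dec.charted ∧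
            Summit.FinalStateConjecture.HasExhaustiveCharts dec) :=
  ⟨trivialData, trivialData_mem_admissibleVacuumData, _, settledIn_minkowski⟩

/-- **What `P(trivialData)` still owes, exactly**: maximality of the Minkowski development (PDE: every
vacuum Cauchy development of `(ℝ³, δ, 0)` embeds into `(ℝ⁴, η)` — the simplest case of
Choquet-Bruhat–Geroch, not in the tree) and transport of `Q` along isometries of developments. MGHD
uniqueness is a tree theorem (`VacuumCauchyDevelopment.isIsometricTo_of_isMaximal'`), and `Q` holds in
Minkowski (`settledIn_minkowski`); the transport hypothesis `htr` is geometrically evident but unproved in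
the tree (it needs geodesic naturality under isometries). [cite: ChoquetBruhatGeroch1969CMP, Thm. 3] -/
theorem settles_trivialData_of (hmax : Minkowski.vacuumCauchyDevelopment.IsMaximal)
    (htr : ∀ {𝒟₁ 𝒟 : VacuumCauchyDevelopment trivialData},
      𝒟₁.toCauchyDevelopment.IsIsometricTo 𝒟.toCauchyDevelopment →
        (Summit.FinalStateConjecture.HasCompleteNullInfinity 𝒟₁.toCauchyDevelopment ∧
          ∃ (O : Set 𝒟₁.carrier) (dec : FinalStateDecomposition 𝒟₁.toSpacetime O 2),
            (∀ i, Kerr.IsSubextremal (dec.mass i) (dec.spin i)) ∧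
              O = Summit.FinalStateConjecture.exteriorOf 𝒟₁.toCauchyDevelopment dec.charted ∧
                Summit.FinalStateConjecture.HasExhaustiveCharts dec) →
        (Summit.FinalStateConjecture.HasCompleteNullInfinity 𝒟.toCauchyDevelopment ∧
      ∃ (O : Set 𝒟.carrier) (dec : FinalStateDecomposition 𝒟.toSpacetime O 2),
        (∀ i, Kerr.IsSubextremal (dec.mass i) (dec.spin i)) ∧
          O = Summit.FinalStateConjecture.exteriorOf 𝒟.toCauchyDevelopment dec.charted ∧
            Summit.FinalStateConjecture.HasExhaustiveCharts dec)) :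
    (∃ 𝒟 : VacuumCauchyDevelopment trivialData, 𝒟.IsMaximal) ∧
      ∀ 𝒟 : VacuumCauchyDevelopment trivialData, 𝒟.IsMaximal →
        (Summit.FinalStateConjecture.HasCompleteNullInfinity 𝒟.toCauchyDevelopment ∧
      ∃ (O : Set 𝒟.carrier) (dec : FinalStateDecomposition 𝒟.toSpacetime O 2),
        (∀ i, Kerr.IsSubextremal (dec.mass i) (dec.spin i)) ∧
          O = Summit.FinalStateConjecture.exteriorOf 𝒟.toCauchyDevelopment dec.charted ∧
            Summit.FinalStateConjecture.HasExhaustiveCharts dec) :=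
  ⟨⟨_, hmax⟩, fun _ h𝒟 ↦
    htr (VacuumCauchyDevelopment.isIsometricTo_of_isMaximal' hmax h𝒟) settledIn_minkowski⟩

end MinkowskiModel

end Summit.FinalStateConjecture.FinalStateConjecture.Theorems.UniversalWitnessFamily.Negative

end
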